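import Summits.AtomisticToContinuum.HydrodynamicLimit.Theses.AntiMazurCoboundaries
import Literature.MathematicalPhysics.KineticTheory.HardSphereEulerProofs
import Literature.Analysis.FluidPDE.HardSphereAlexander
import Literature.Analysis.FluidPDE.HardSphereFlowJointMeasurable
import Summits.AtomisticToContinuum.HydrodynamicLimit.Theorems.JParityClosureOddContactSymmetryGibbsInvariance

/-!
# `ShearStressHalfDrude` is false without `e₁ ⊥ e₂`: centring of the observable is load-bearing

Negative knowledge for the crux `AntiMazurCoboundaries.ShearStressHalfDrude` (stmt-AtomisticToContinuum-14136),
from the standing disprover's `Cruxes/ShearStressHalfDrude/Disproof.lean`.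
`ShearStressHalfDrudeWithoutOrth` is the crux VERBATIM with the hypothesis `inner ℝ e₁ e₂ = 0` deleted, and it
is FALSE for every window `τ` and every threshold `N₀`: take `a = θ = 1`, `u₀ = 0`, `e₁ = e₂ = (1,0,0)`, `A = 1`,
`φ = 1`. Then `g = gS = w₀²(1 − smoothTransition(‖w‖² − 1)) ≥ 0` has Gaussian mean `m > 0`
(`integral_gS_pos`), the one-body functional `F = Σᵢ gS(vᵢ)` has Gibbs mean `(N+1)m`
(`integral_F_localGibbsMeasure`, by the tree's disintegration `lintegral_localGibbsMeasure`), and the WINDOW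
AVERAGE `X = h⁻¹∫₀ʰ F∘Φ_s ds` has the SAME mean (`integral_window_eq`: joint measurability of the flow on its
good set `HardSphereFlow.measurable_flow_prod_torus`, Fubini, and stationarity of the homogeneous Gibbs law
`integral_comp_flow_localGibbsLaw_const`). By Cauchy–Schwarz (`variance_eq_sub`, `variance_nonneg`)
`∫ X² dG_N ≥ ((N+1)m)²`, which exceeds the crux's bound `½(N+1)·1·∫gS²dγ` as soon as `N + 1 > ∫gS²dγ/m²`;
flows exist for every `N` by the tree's Alexander theorem `HardSphereFlow.nonempty_torus_holds`.

Consequences for provers: (i) any proof must use that `g` is CENTRED under the Maxwellian — at finite `N` the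
orthogonality to `w` and `|w|²` only removes `O(1/N)` Mazur floors, but orthogonality to `1` removes an `O(N)`
one; (ii) the by-product `integral_window_eq` — `∫(∫₀ʰ f∘Φ_s ds) dG_N = h ∫ f dG_N` for bounded measurable `f`,
every flow and every window — is the exact centring identity `E[window average] = E[F]` that the positive
proof (VarianceCertificate route) starts from. Unconditional; axioms `propext`, `Classical.choice`, `Quot.sound`.
refuter-cdisprove-stmt-AtomisticToContinuum-14136-0.
-/

noncomputable section

open MeasureTheory ProbabilityTheory Filter Set Topology Real
open scoped ENNReal NNReal InnerProductSpace

namespace Summit.AtomisticToContinuum.HydrodynamicLimit.Theorems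

open Literature.MathematicalPhysics.KineticTheory Literature.Analysis.FluidPDE

/-- The crux with the orthogonality hypothesis `inner ℝ e₁ e₂ = 0` DROPPED (all else verbatim). -/
def ShearStressHalfDrudeWithoutOrth : Prop :=
  ∀ (a θ : ℝ) (u₀ : Literature.MathematicalPhysics.KineticTheory.V3), 0 < a → 0 < θ → ∃ σ₀ : ℝ, 0 < σ₀ ∧ ∀ σ : ℝ, 0 < σ → σ < σ₀ → (∀ (N : ℕ) (Φ : Literature.Analysis.FluidPDE.HardSphereFlow (Literature.Analysis.FluidPDE.Torus.geometry (Fin 3)) (Literature.MathematicalPhysics.KineticTheory.hsDiameter σ N) (N + 1)), MeasureTheory.IsProbabilityMeasure (Literature.MathematicalPhysics.KineticTheory.localGibbsLaw σ (fun _ => a) (fun _ => u₀) (fun _ => θ) N Φ)) ∧ ∀ (e₁ e₂ : Literature.MathematicalPhysics.KineticTheory.V3), ∀ A : ℝ, 0 < A → ∀ g : Literature.MathematicalPhysics.KineticTheory.V3 → ℝ, (g = fun w => inner ℝ e₁ w * inner ℝ e₂ w * (1 - Real.smoothTransition (‖w‖ ^ 2 / A ^ 2 - 1))) → ∀ φ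 : Literature.MathematicalPhysics.KineticTheory.T3 → ℝ, Continuous φ → ∃ τ : ℝ, 0 < τ ∧ ∃ N₀ : ℕ, ∀ N : ℕ, N₀ ≤ N → ∀ Φ : Literature.Analysis.FluidPDE.HardSphereFlow (Literature.Analysis.FluidPDE.Torus.geometry (Fin 3)) (Literature.MathematicalPhysics.KineticTheory.hsDiameter σ N) (N + 1), ∫⁻ z, ENNReal.ofReal (((τ * ((N + 1 : ℕ) : ℝ) ^ (-(1 / 3 : ℝ)))⁻¹ * ∫ s in (0 : ℝ)..(τ * ((N + 1 : ℕ) : ℝ) ^ (-(1 / 3 : ℝ))), ∑ i, φ (Φ.flow s z i).1 * g ((Real.sqrt θ)⁻¹ • ((Φ.flow s z i).2 - u₀))) ^ 2) ∂(Literature.MathematicalPhysics.KineticTheory.localGibbsLaw σ (fun _ => a) (fun _ => u₀) (fun _ => θ) N Φ) ≤ ENNReal.ofReal ((1 / 2) * (((N : ℝ)) + 1) * (∫ x, φ x ^ 2) * ∫ v, g v ^ 2 ∂(ProbabilityTheory.stdGaussian Literature.MathematicalPhysics.KineticTheory.V3))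


namespace ShearStressHalfDrudeNonCentred

/-- `e₁ = (1,0,0)`. -/
def E1 : V3 := EuclideanSpace.single 0 1

/-- `⟪e₁, w⟫ = w₀`. [folklore] -/
theorem inner_E1 (w : V3) : ⟪E1, w⟫_ℝ = w 0 := by
  simp [E1, EuclideanSpace.inner_single_left]

/-- The NON-centred observable obtained from the crux's `g` at `e₁ = e₂ = (1,0,0)`, `A = 1`:
`w₀² (1 − smoothTransition (‖w‖² − 1)) ≥ 0`, written exactly as the crux instantiates it. -/
def gS : V3 → ℝ := fun w =>
  inner ℝ E1 w * inner ℝ E1 w * (1 - Real.smoothTransition (‖w‖ ^ 2 / (1 : ℝ) ^ 2 - 1))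

/-- `gS` is continuous. [folklore] -/
theorem continuous_gS : Continuous gS := by
  unfold gS
  refine ((continuous_const.inner continuous_id).mul (continuous_const.inner continuous_id)).mul
    (continuous_const.sub (Real.smoothTransition.continuous.comp ?_))
  fun_prop

/-- `gS ≥ 0`. [folklore] -/
theorem gS_nonneg (w : V3) : 0 ≤ gS w := by
  unfold gS
  refine mul_nonneg (mul_self_nonneg _) ?_
  exact sub_nonneg.2 (Real.smoothTransition.le_one _)

/-- The cutoff kills `gS` outside the ball of radius `2`. [folklore] -/
theorem gS_eq_zero_of_two_le {w : V3} (hw : 2 ≤ ‖w‖) : gS w = 0 := by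
  have h1 : (1 : ℝ) ≤ ‖w‖ ^ 2 / (1 : ℝ) ^ 2 - 1 := by
    rw [one_pow, div_one]
    nlinarith
  unfold gS
  rw [Real.smoothTransition.one_of_one_le h1, sub_self, mul_zero]

/-- `gS ≤ 4`. [folklore] -/
theorem gS_le_four (w : V3) : gS w ≤ 4 := by
  by_cases hw : 2 ≤ ‖w‖
  · rw [gS_eq_zero_of_two_le hw]; norm_num
  · rw [not_le] at hw
    have hin : |⟪E1, w⟫_ℝ| ≤ ‖w‖ := by
      have := abs_real_inner_le_norm E1 w
      have hE : ‖E1‖ = 1 := by simp [E1, PiLp.norm_single]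
      simpa [hE] using this
    have hsq : ⟪E1, w⟫_ℝ * ⟪E1, w⟫_ℝ ≤ ‖w‖ ^ 2 := by
      have := sq_abs ⟪E1, w⟫_ℝ
      nlinarith [abs_nonneg ⟪E1, w⟫_ℝ, norm_nonneg w]
    have hc0 : 0 ≤ 1 - Real.smoothTransition (‖w‖ ^ 2 / (1 : ℝ) ^ 2 - 1) :=
      sub_nonneg.2 (Real.smoothTransition.le_one _)
    have hc1 : 1 - Real.smoothTransition (‖w‖ ^ 2 / (1 : ℝ) ^ 2 - 1) ≤ 1 :=
      sub_le_self _ (Real.smoothTransition.nonneg _)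
    unfold gS
    calc ⟪E1, w⟫_ℝ * ⟪E1, w⟫_ℝ * (1 - Real.smoothTransition (‖w‖ ^ 2 / (1 : ℝ) ^ 2 - 1))
        ≤ ‖w‖ ^ 2 * 1 := mul_le_mul hsq hc1 hc0 (sq_nonneg _)
      _ ≤ 4 := by nlinarith [norm_nonneg w]

/-- `|gS| ≤ 4`. [folklore] -/
theorem abs_gS_le (w : V3) : |gS w| ≤ 4 := by
  rw [abs_of_nonneg (gS_nonneg w)]; exact gS_le_four w

/-- `gS` has compact support. [folklore] -/
theorem hasCompactSupport_gS : HasCompactSupport gS := by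
  refine HasCompactSupport.intro (isCompact_closedBall (0 : V3) 2) fun w hw => ?_
  refine gS_eq_zero_of_two_le ?_
  rw [Metric.mem_closedBall, dist_zero_right, not_le] at hw
  exact hw.le

/-- `gS (½,0,0) = ¼`. [folklore] -/
theorem gS_half : gS (EuclideanSpace.single 0 (1 / 2 : ℝ)) = 1 / 4 := by
  have hn : ‖(EuclideanSpace.single 0 (1 / 2 : ℝ) : V3)‖ = 1 / 2 := by
    rw [PiLp.norm_single]; norm_num
  have h0 : ‖(EuclideanSpace.single 0 (1 / 2 : ℝ) : V3)‖ ^ 2 / (1 : ℝ) ^ 2 - 1 ≤ 0 := by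
    rw [hn]; norm_num
  rw [gS, Real.smoothTransition.zero_of_nonpos h0, inner_E1]
  simp
  norm_num

/-- The Gaussian mean of `gS` is positive. [folklore] -/
theorem integral_gS_pos : 0 < ∫ v, gS v ∂stdGaussian V3 := by
  rw [integral_stdGaussian_eq_integral_mul_globalMaxwellian]
  have hc : Continuous fun v : V3 => globalMaxwellian v * gS v :=
    continuous_globalMaxwellian.mul continuous_gS
  have hs : HasCompactSupport fun v : V3 => globalMaxwellian v * gS v :=
    hasCompactSupport_gS.mul_left
  have hnn : 0 ≤ fun v : V3 => globalMaxwellian v * gS v := fun v =>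
    mul_nonneg (globalMaxwellian_pos v).le (gS_nonneg v)
  have hx : (fun v : V3 => globalMaxwellian v * gS v) (EuclideanSpace.single 0 (1 / 2 : ℝ)) ≠ 0 := by
    simp only [gS_half, ne_eq, mul_eq_zero, not_or]
    exact ⟨(globalMaxwellian_pos _).ne', by norm_num⟩
  exact hc.integral_pos_of_hasCompactSupport_nonneg_nonzero hs hnn hx

/-- `gS` and `gS²` are integrable for the standard Gaussian. [folklore] -/
theorem integrable_gS : Integrable gS (stdGaussian V3) :=
  continuous_gS.integrable_of_hasCompactSupport hasCompactSupport_gS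

/-! ### The one-body functional `F = Σᵢ gS(vᵢ)` and its Gibbs mean -/

/-- `F(z) = Σᵢ gS(vᵢ)`. -/
def F (n : ℕ) (z : Config n (Fin 3) T3) : ℝ := ∑ i, gS ((z i).2)

/-- `F` is continuous. [folklore] -/
theorem continuous_F (n : ℕ) : Continuous (F n) := by
  unfold F
  refine continuous_finsetSum _ fun i _ => ?_
  exact continuous_gS.comp ((continuous_apply i).snd)

/-- `0 ≤ F ≤ 4n`. [folklore] -/
theorem F_nonneg (n : ℕ) (z : Config n (Fin 3) T3) : 0 ≤ F n z :=
  Finset.sum_nonneg fun _ _ => gS_nonneg _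

/-- `F ≤ 4n`. [folklore] -/
theorem F_le (n : ℕ) (z : Config n (Fin 3) T3) : F n z ≤ 4 * n := by
  unfold F
  calc ∑ i, gS ((z i).2) ≤ ∑ _i : Fin n, (4 : ℝ) := Finset.sum_le_sum fun _ _ => gS_le_four _
    _ = 4 * n := by simp [mul_comm]

/-- `|F| ≤ 4n`. [folklore] -/
theorem abs_F_le (n : ℕ) (z : Config n (Fin 3) T3) : |F n z| ≤ 4 * n := by
  rw [abs_of_nonneg (F_nonneg n z)]; exact F_le n z

/-- One-body velocity expectations under the homogeneous Gibbs measure (`a = θ = 1`, `u₀ = 0`) are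
standard Gaussian expectations, particle by particle. [folklore] -/
theorem lintegral_vel_localGibbsMeasure {σ : ℝ} (hσ : σ ≤ 1 / 2) (N : ℕ) (i : Fin (N + 1))
    {H : V3 → ℝ≥0∞} (hH : Measurable H) :
    ∫⁻ z, H ((z i).2) ∂localGibbsMeasure σ (fun _ => 1) (fun _ => 0) (fun _ => 1) N =
      ∫⁻ w, H w ∂stdGaussian V3 := by
  haveI := isProbabilityMeasure_localGibbsMeasure (a₀ := fun _ : T3 => (1 : ℝ))
    (θ₀ := fun _ : T3 => (1 : ℝ)) (u₀ := fun _ : T3 => (0 : V3)) continuous_const continuous_const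
    continuous_const (fun _ => one_pos) (fun _ => one_pos) hσ N
  have hG : Measurable fun z : Config (N + 1) (Fin 3) T3 => H ((z i).2) :=
    hH.comp (measurable_pi_apply i).snd
  rw [lintegral_localGibbsMeasure (a₀ := fun _ : T3 => (1 : ℝ)) (θ₀ := fun _ : T3 => (1 : ℝ))
    (u₀ := fun _ : T3 => (0 : V3)) continuous_const continuous_const continuous_const
    (fun _ => zero_le_one) (fun _ => one_pos) σ N hG]
  have hinner : ∀ x : Fin (N + 1) → T3,
      ∫⁻ v, H ((zipConfig (x, v) i).2) ∂velMeasure (fun _ => (0 : V3)) (fun _ => (1 : ℝ)) x =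
        ∫⁻ w, H w ∂stdGaussian V3 := by
    intro x
    have hmp : MeasurePreserving (Function.eval i)
        (velMeasure (fun _ => (0 : V3)) (fun _ => (1 : ℝ)) x) (gaussMeasure (0 : V3) 1) := by
      unfold velMeasure
      exact measurePreserving_eval _ i
    have hgauss : gaussMeasure (0 : V3) 1 = stdGaussian V3 := by simp [gaussMeasure]
    rw [← hgauss, ← hmp.lintegral_comp hH]
    rfl
  simp_rw [hinner]
  rw [lintegral_mul_const _ ?_, lintegral_posWeight_eq_one (a₀ := fun _ : T3 => (1 : ℝ))
    (θ₀ := fun _ : T3 => (1 : ℝ)) (u₀ := fun _ : T3 => (0 : V3)) continuous_const continuous_const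
    continuous_const (fun _ => zero_le_one) (fun _ => one_pos) σ N, one_mul]
  exact ((measurable_posWeight continuous_const _ _).const_mul _).ennreal_ofReal

/-- The Gibbs mean of `F` is `(N+1) ∫ gS dγ`. [folklore] -/
theorem integral_F_localGibbsMeasure {σ : ℝ} (hσ : σ ≤ 1 / 2) (N : ℕ) :
    ∫ z, F (N + 1) z ∂localGibbsMeasure σ (fun _ => 1) (fun _ => 0) (fun _ => 1) N =
      (N + 1) * ∫ v, gS v ∂stdGaussian V3 := by
  set μ := localGibbsMeasure σ (fun _ => (1 : ℝ)) (fun _ => (0 : V3)) (fun _ => (1 : ℝ)) N with hμ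
  haveI : IsProbabilityMeasure μ := isProbabilityMeasure_localGibbsMeasure (a₀ := fun _ : T3 => (1 : ℝ))
    (θ₀ := fun _ : T3 => (1 : ℝ)) (u₀ := fun _ : T3 => (0 : V3)) continuous_const continuous_const
    continuous_const (fun _ => one_pos) (fun _ => one_pos) hσ N
  have hterm : ∀ i : Fin (N + 1), ∫ z, gS ((z i).2) ∂μ = ∫ v, gS v ∂stdGaussian V3 := by
    intro i
    have hmeas : Measurable fun z : Config (N + 1) (Fin 3) T3 => gS ((z i).2) :=
      continuous_gS.measurable.comp (measurable_pi_apply i).snd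
    have hint : Integrable (fun z : Config (N + 1) (Fin 3) T3 => gS ((z i).2)) μ :=
      Integrable.of_bound hmeas.aestronglyMeasurable 4 (ae_of_all _ fun z => by
        rw [Real.norm_eq_abs]; exact abs_gS_le _)
    rw [integral_eq_lintegral_of_nonneg_ae (ae_of_all _ fun z => gS_nonneg _) hmeas.aestronglyMeasurable,
      integral_eq_lintegral_of_nonneg_ae (ae_of_all _ fun v => gS_nonneg _)
        continuous_gS.measurable.aestronglyMeasurable]
    congr 1
    exact lintegral_vel_localGibbsMeasure hσ N i (continuous_gS.measurable.ennreal_ofReal)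
  unfold F
  rw [integral_finsetSum _ fun i _ => ?_]
  · simp_rw [hterm]
    simp
  · have hmeas : Measurable fun z : Config (N + 1) (Fin 3) T3 => gS ((z i).2) :=
      continuous_gS.measurable.comp (measurable_pi_apply i).snd
    exact Integrable.of_bound hmeas.aestronglyMeasurable 4 (ae_of_all _ fun z => by
      rw [Real.norm_eq_abs]; exact abs_gS_le _)

/-! ### Fubini in time + stationarity: the Gibbs mean of a window integral -/

/-- **Mean of a window integral under the stationary Gibbs law**: for constant profiles, every flow,
every bounded measurable observable `f` and every window `h > 0`,
`∫ (∫₀ʰ f(Φ_s z) ds) dG_N = h ∫ f dG_N` (joint measurability of the flow on its good set, Fubini,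
and `(Φ_s)_# G_N = G_N`). [folklore] -/
theorem integral_window_eq (σ a θ : ℝ) (u : V3) (N : ℕ)
    (Φ : HardSphereFlow (Torus.geometry (Fin 3)) (hsDiameter σ N) (N + 1))
    [IsFiniteMeasure (localGibbsLaw σ (fun _ => a) (fun _ => u) (fun _ => θ) N Φ)]
    {f : Config (N + 1) (Fin 3) T3 → ℝ} (hf : Measurable f) {C : ℝ} (hC : ∀ z, |f z| ≤ C)
    {h : ℝ} (hh : 0 < h) :
    ∫ z, (∫ s in (0 : ℝ)..h, f (Φ.flow s z)) ∂(localGibbsLaw σ (fun _ => a) (fun _ => u) (fun _ => θ) N Φ) =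
      h * ∫ z, f z ∂(localGibbsLaw σ (fun _ => a) (fun _ => u) (fun _ => θ) N Φ) := by
  set μ := localGibbsLaw σ (fun _ => a) (fun _ => u) (fun _ => θ) N Φ with hμ
  set ν : Measure ℝ := volume.restrict (Ioc (0 : ℝ) h) with hν
  haveI : IsFiniteMeasure ν := by
    rw [hν]; exact isFiniteMeasure_restrict.2 (by simp)
  -- the law is carried by the good set
  have hac : μ ≪ liouville (Torus.geometry (Fin 3)) (N + 1) (hsDiameter σ N) :=
    withDensity_absolutelyContinuous _ _
  have hgood : μ Φ.goodᶜ = 0 := hac Φ.measure_compl_good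
  -- a measurable modification of the uncurried integrand
  set S : Set (Config (N + 1) (Fin 3) T3 × ℝ) := Φ.good ×ˢ (univ : Set ℝ) with hS
  have hSm : MeasurableSet S := Φ.measurableSet_good.prod MeasurableSet.univ
  have hflowS : Measurable fun p : S => f (Φ.flow p.1.2 p.1.1) := by
    have hmk : Measurable fun p : S => ((⟨p.1.1, (mem_prod.1 p.2).1⟩ : Φ.good), p.1.2) :=
      ((measurable_fst.comp measurable_subtype_coe).subtype_mk).prodMk
        (measurable_snd.comp measurable_subtype_coe)
    exact hf.comp ((Φ.measurable_flow_prod_torus).comp hmk)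
  classical
  set G : Config (N + 1) (Fin 3) T3 × ℝ → ℝ := fun p =>
    if hp : p ∈ S then f (Φ.flow p.2 p.1) else 0 with hG
  have hGm : Measurable G := by
    have := Measurable.dite (s := S) (f := fun p : S => f (Φ.flow p.1.2 p.1.1))
      (g := fun _ => (0 : ℝ)) hflowS measurable_const hSm
    convert this using 1
  have hGbd : ∀ p, |G p| ≤ |C| := by
    intro p
    by_cases hp : p ∈ S
    · simp only [hG, hp, dite_true]; exact (hC _).trans (le_abs_self C)
    · simp only [hG, hp, dite_false, abs_zero]; exact abs_nonneg C
  have hGint : Integrable G (μ.prod ν) :=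
    Integrable.of_bound hGm.aestronglyMeasurable |C| (ae_of_all _ fun p => by
      rw [Real.norm_eq_abs]; exact hGbd p)
  -- the uncurried integrand agrees with `G` almost everywhere
  have hSc : (μ.prod ν) Sᶜ = 0 := by
    have hsub : Sᶜ ⊆ Φ.goodᶜ ×ˢ (univ : Set ℝ) := by
      intro p hp
      simp only [hS, mem_compl_iff, mem_prod, mem_univ, and_true] at hp
      exact ⟨hp, mem_univ _⟩
    refine measure_mono_null hsub ?_
    rw [Measure.prod_prod, hgood, zero_mul]
  have hae : (Function.uncurry fun z s => f (Φ.flow s z)) =ᵐ[μ.prod ν] G := by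
    refine (ae_iff.2 (measure_mono_null (fun p hp => ?_) hSc))
    intro hpS
    exact hp (by simp only [hG, hpS, dite_true]; rfl)
  have hint : Integrable (Function.uncurry fun z s => f (Φ.flow s z)) (μ.prod ν) :=
    hGint.congr hae.symm
  -- Fubini and stationarity
  simp_rw [intervalIntegral.integral_of_le hh.le]
  rw [integral_integral_swap hint]
  have hinv : ∀ s, ∫ z, f (Φ.flow s z) ∂μ = ∫ z, f z ∂μ := fun s =>
    integral_comp_flow_localGibbsLaw_const σ a θ u N Φ s hf.aestronglyMeasurable
  simp_rw [hinv]
  rw [setIntegral_const]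
  simp [Measure.real, Real.volume_Ioc, hh.le]

/-! ### The crux without orthogonality, and its refutation -/

/-- **Centring is load-bearing**: without `e₁ ⊥ e₂` the crux is false. Witness `e₁ = e₂ = (1,0,0)`,
`A = 1`, `φ = 1`, `a = θ = 1`, `u₀ = 0`: `g = gS ≥ 0` has Gaussian mean `m > 0`; by stationarity of `G_N`
and Fubini the window average has mean `(N+1)m`, so by Cauchy–Schwarz its second moment is
`≥ ((N+1)m)²`, which beats `½(N+1)∫g²dγ` as soon as `N + 1 > ∫g²dγ/m²`. [folklore] -/
theorem shearStressHalfDrudeWithoutOrth_false : ¬ ShearStressHalfDrudeWithoutOrth := by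
  intro hcrux
  obtain ⟨σ₀, hσ₀, hσ⟩ := hcrux 1 1 0 one_pos one_pos
  obtain ⟨σ, hσpos, hσlt, hσhalf, hσhalf'⟩ : ∃ σ : ℝ, 0 < σ ∧ σ < σ₀ ∧ σ ≤ 1 / 2 ∧ σ < 2⁻¹ :=
    ⟨min (σ₀ / 2) (1 / 4), lt_min (by linarith) (by norm_num),
      (min_le_left _ _).trans_lt (by linarith), (min_le_right _ _).trans (by norm_num),
      (min_le_right _ _).trans_lt (by norm_num)⟩
  obtain ⟨-, hmain⟩ := hσ σ hσpos hσlt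
  obtain ⟨τ, hτ, N₀, hwin⟩ := hmain E1 E1 1 one_pos gS rfl (fun _ => 1) continuous_const
  clear hmain hσ hcrux
  -- the two Gaussian constants
  have hmpos : 0 < ∫ v, gS v ∂stdGaussian V3 := integral_gS_pos
  have hs2nn : 0 ≤ ∫ v, gS v ^ 2 ∂stdGaussian V3 := integral_nonneg fun v => sq_nonneg _
  set m := ∫ v, gS v ∂stdGaussian V3 with hm
  set s2 := ∫ v, gS v ^ 2 ∂stdGaussian V3 with hs2
  -- a large particle number
  obtain ⟨N, hN₀, hNbig⟩ : ∃ N : ℕ, N₀ ≤ N ∧ s2 < ((N : ℝ) + 1) * m ^ 2 := by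
    obtain ⟨k, hk⟩ := exists_nat_gt (s2 / m ^ 2)
    refine ⟨max N₀ k, le_max_left _ _, ?_⟩
    have hm2 : 0 < m ^ 2 := by positivity
    have hk' : s2 / m ^ 2 < ((max N₀ k : ℕ) : ℝ) + 1 := by
      have : (k : ℝ) ≤ ((max N₀ k : ℕ) : ℝ) := by exact_mod_cast le_max_right N₀ k
      linarith
    rw [div_lt_iff₀ hm2] at hk'
    linarith
  -- a flow of N+1 spheres (Alexander, in the tree)
  have hεpos : 0 < hsDiameter σ N := hsDiameter_pos hσpos N
  have hεlt : hsDiameter σ N < 2⁻¹ := (hsDiameter_le hσpos.le N).trans_lt hσhalf'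
  obtain ⟨Φ⟩ := HardSphereFlow.nonempty_torus_holds (d := Fin 3) hεpos hεlt (N + 1)
  have hle := hwin N hN₀ Φ
  clear hwin
  set μ := localGibbsLaw σ (fun _ => (1 : ℝ)) (fun _ => (0 : V3)) (fun _ => (1 : ℝ)) N Φ with hμ
  haveI : IsProbabilityMeasure μ := isProbabilityMeasure_localGibbsLaw (a₀ := fun _ : T3 => (1 : ℝ))
    (θ₀ := fun _ : T3 => (1 : ℝ)) (u₀ := fun _ : T3 => (0 : V3)) continuous_const continuous_const
    continuous_const (fun _ => one_pos) (fun _ => one_pos) hσhalf N Φ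
  set h := τ * ((N + 1 : ℕ) : ℝ) ^ (-(1 / 3 : ℝ)) with hh
  have hhpos : 0 < h := mul_pos hτ (Real.rpow_pos_of_pos (by positivity) _)
  -- the verbose integrand is `F ∘ Φ_s`
  have hverb : ∀ z : Config (N + 1) (Fin 3) T3,
      (∑ i, 1 * gS ((Real.sqrt 1)⁻¹ • ((z i).2 - 0))) = F (N + 1) z := by
    intro z
    simp [F]
  have hFm : Measurable (F (N + 1)) := (continuous_F _).measurable
  have hac : μ ≪ liouville (Torus.geometry (Fin 3)) (N + 1) (hsDiameter σ N) :=
    withDensity_absolutelyContinuous _ _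
  have hgoodc : μ Φ.goodᶜ = 0 := hac Φ.measure_compl_good
  -- the window average X and its bound
  set X : Config (N + 1) (Fin 3) T3 → ℝ := fun z =>
    h⁻¹ * ∫ s in (0 : ℝ)..h, F (N + 1) (Φ.flow s z) with hX
  have hXae : AEMeasurable X μ :=
    (Φ.aemeasurable_intervalIntegral_comp_flow_torus hFm 0 h hgoodc).const_mul h⁻¹
  have hXbd : ∀ z, |X z| ≤ 4 * ((N + 1 : ℕ) : ℝ) := by
    intro z
    simp only [hX]
    rw [abs_mul, abs_inv, abs_of_pos hhpos]
    have hI := intervalIntegral.norm_integral_le_of_norm_le_const (a := (0 : ℝ)) (b := h)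
      (C := 4 * ((N + 1 : ℕ) : ℝ)) (f := fun s => F (N + 1) (Φ.flow s z))
      (fun s _ => by rw [Real.norm_eq_abs]; exact abs_F_le _ _)
    rw [Real.norm_eq_abs, sub_zero, abs_of_pos hhpos] at hI
    calc h⁻¹ * |∫ s in (0 : ℝ)..h, F (N + 1) (Φ.flow s z)|
        ≤ h⁻¹ * (4 * ((N + 1 : ℕ) : ℝ) * h) := by gcongr
      _ = 4 * ((N + 1 : ℕ) : ℝ) := by field_simp
  have hXaesm : AEStronglyMeasurable X μ := hXae.aestronglyMeasurable
  have hXmem : MemLp X 2 μ :=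
    MemLp.of_bound hXaesm (4 * ((N + 1 : ℕ) : ℝ)) (ae_of_all _ fun z => by
      rw [Real.norm_eq_abs]; exact hXbd z)
  -- mean of X: stationarity + Fubini
  have hmean : ∫ z, X z ∂μ = ((N : ℝ) + 1) * m := by
    simp only [hX]
    rw [integral_const_mul, integral_window_eq σ 1 1 0 N Φ hFm (fun z => abs_F_le _ z) hhpos,
      ← mul_assoc, inv_mul_cancel₀ hhpos.ne', one_mul, localGibbsLaw_eq]
    exact_mod_cast integral_F_localGibbsMeasure hσhalf N
  -- second moment ≥ mean²
  have hvar : (((N : ℝ) + 1) * m) ^ 2 ≤ ∫ z, X z ^ 2 ∂μ := by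
    have h1 := variance_nonneg X μ
    rw [variance_eq_sub hXmem, hmean] at h1
    simp only [Pi.pow_apply] at h1
    linarith
  -- compare with the crux's bound
  have hT3 : ∫ x : T3, (1 : ℝ) ^ 2 = 1 := by simp
  have hle' : ENNReal.ofReal (∫ z, X z ^ 2 ∂μ) ≤ ENNReal.ofReal (1 / 2 * ((N : ℝ) + 1) * s2) := by
    convert hle using 1
    · rw [ofReal_integral_eq_lintegral_ofReal hXmem.integrable_sq (ae_of_all _ fun z => sq_nonneg _)]
      refine lintegral_congr fun z => ?_
      simp only [hX, hverb]
    · rw [hT3, mul_one]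
  have hfin := (ENNReal.ofReal_le_ofReal_iff (by positivity)).1 hle'
  have hNpos : (0 : ℝ) < (N : ℝ) + 1 := by positivity
  have hkey : ((N : ℝ) + 1) * m ^ 2 ≤ s2 / 2 := by
    have := hvar.trans hfin
    rw [mul_pow] at this
    nlinarith
  linarith

end ShearStressHalfDrudeNonCentred

end Summit.AtomisticToContinuum.HydrodynamicLimit.Theorems

end
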